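import Literature.MathematicalPhysics.QuantumFieldTheory.Balaban1983to89.B4ThmZeroTorusEta
import Literature.MathematicalPhysics.QuantumFieldTheory.Balaban1983to89.B5GpSettingTorus
import Literature.MathematicalPhysics.QuantumFieldTheory.Balaban1983to89.B5ResidualGpTorus

/-!
# B5 p. 39 «In paper [2] we have proved all the necessary properties of G′» — THE DICTIONARY `B5FromB4.Dict` between [2]'s
# Theorem on the torus (`B4ThmZeroTorusEta.torusEtaFam`) and the G′-setting of record (`B5GpSettingTorus.gpSetting`) at the
# top level k = K, PROVED; hence the first-order entries (1.110)–(1.111) FOR G′_K (`B5FromB4.FirstOrderFam`) on every torus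

statement-level skeleton of published theorems with citation tags; proofs where landed; nothing here is a claim about the
Yang–Mills mass gap

B5 = T. Bałaban, *Propagators and renormalization transformations for lattice gauge theories. I*, Commun. Math. Phys. **95**
(1984) 17–40 [cite: Balaban1984PropagatorsI] (pp. 35–36 [PDF 19–20], p. 39 [PDF 23] read); B4 = [2] of B5 = T. Bałaban, *Regularity
and decay of lattice Green's functions*, Commun. Math. Phys. **89** (1983) 571–597 [cite: Balaban1983RegularityDecay] (pp. 572–573
read).  Cell `lit-balaban` (Phase-2 proof seat p38 gen 4), file F3c of the programme «[2]'s Theorem on the torus at A = 0» = census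
item (i) `hThm` of row B5.Prop1.2 (HOME `ROWS-B5.md`, owner r02), the join with seat p37's census item (ix) files
(`B5GpSettingTorus`, `B5ResidualGpTorus`).

## WHAT IS PRINTED (verbatim, B5)

p. 35 [PDF 19]: «|(GJ)(x)|, |(∇GJ)(x)|, |(G∇*J)(x)|, |(ΔGJ)(x)| ≤ O(1)e^{−δ₀|y−y′|}|J| (1.110) for x ∈ Δ̃(y), supp J ⊂ Δ̃(y′) …
‖ζ∇GJ‖_α, ‖ζG∇*J‖_α ≤ O(1)e^{−δ₀|y−y′|}(‖ζ‖_α + |ζ|)|J| (1.111) for 0 ≤ α < 1, ζ ∈ C₀^∞(Δ̃(y)), supp J ⊂ Δ̃(y′) … The operators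
G′_k were investigated in paper [2].»  p. 39 [PDF 23]: «In paper [2] we have proved all the necessary properties of G′, except the
second order inequalities (1.112), (1.113). … We use Lemma 2.4 of that paper and the equality (2.34) with □ replaced by the whole
torus.»  B4 p. 573 [PDF 3]: the Theorem (1.9)–(1.10) (quoted in `B4ThmZeroTorusEta`), «For some simple sets Ω, e.g. for
rectangular parallelepipeds, the inequalities hold without any restrictions on the points x, x′».

## WHAT THIS FILE CERTIFIES (kernel-checked, zero `sorry`)

* §1 `GpTopIdx d L` (a volume `P = (d, L, m, K)`, `K ≥ 1`), the TOP-LEVEL G′-family of record `famGpTop d L a m² o i :=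
  B5GpSettingTorus.gpSetting i.P a m² i.P.K (o i.P)` (`o` = the uninterpreted L² half, per volume) with `holderTop` (`gpHolder`) and
  the index map
  `iotaTop i e : B4ThmZeroTorusEta.TorusEtaIdx d L` (same volume, charge `e`).
* §2 Geometry of the cubes at the top level (`ε = L^{−K}`, `distX_top : distX P K = ε·T₀`): the enlarged cube `bigCube`
  (`|x − y|_T ≤ 2` in `η`-units about the corner representative; contains Δ̃(y) and every partner at distance ≤ 1 of a point of
  Δ̃(y): `inCube_bigCube`, `bigCube_of_near`), and THE CUBE-TO-SUPPORT CONVERSION `geom_big` / `geom1_top` / `geom2_top`: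
  x ∈ bigCube(y), supp J ⊂ Δ̃(y′) ⇒ |y − y′| − 3 ≤ ε·dist_T(x, supp J) (also for J = 0: `B4ThmZeroTorusEta.le_infT`), and the sup-norm
  comparison `norm_le_supNormV` (‖J‖_∞ ≤ |J| of (1.108); in fact equal).
* §3 **`dictAt d L a m² P _ _ _ o e : B5FromB4.Dict (torusEtaFam d L a m² ⟨P, _, _, _, e⟩) (gpSetting P a m² P.K o) (gpHolder …) 3 e`**
  (index-free: any volume `P` with `P.d = d`, `P.L = L`, `K ≥ 1`, any L² half `o`, any charge `e`) and its reading on the top-level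
  family **`dictTop d L a m² o i e : B5FromB4.Dict (torusEtaFam d L a m² (iotaTop i e)) (famGpTop d L a m² o i) (holderTop … i) 3 e`**
  — EVERY field of the cell's [2]-dictionary PROVED for the concrete pair (c = 3): `loc = id` (J is [2]'s f : Ω → R^N, N = d),
  `inCube = bigCube`, `inPair x x′ y = (x ∈ Δ̃(y), x ≠ x′, |x − x′| ≤ 1)`, `e0_le`/`e1_le` from `B5GpSettingTorus.entry_zero_le`/
  `entry_one_le` + `E0_top`/`ED_top` (at k = K the setting's G′_K, ∂^ηG′_K ARE [2]'s G_K, D^ηG_K), `hD_le` from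
  `B5GpSettingTorus.hDV_le_of_pair` (the product rule) with the Hölder quotient of (1.9) converted by `le_mul_rpow_of_weighted`.
* §4 **`firstOrderFam_top_of_residual`**: `ResidualGpFirst ⇒ B5FromB4.FirstOrderFam (famGpTop d L a m² o)` — the edge
  `B5FromB4NN.firstOrderGp_of_B4NN` fed with `B4ThmZeroTorusEta.thmDepPrintedNN_torusEtaFam` (hypothesis-free [2]-half) and §3;
  **`residualGpFirst_top : B5FromB4.ResidualGpFirst (famGpTop d L a m² o) (holderTop d L a m² o)`** — seat p37's
  `B5ResidualGpTorus.residualGpFirst_torus` at its own dictionaries `dict137_gpSetting`/`dictGp_gpSetting`/`modelSigns_gpSetting`/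
  `cubeFacts_gpSetting` (the top-level instance of p37's announced `B5ResidualGpTorusHolds`); hence **`firstOrderFam_top :
  B5FromB4.FirstOrderFam (famGpTop d L a m² o)` HYPOTHESIS-FREE** — (1.110)–(1.111) for G′ = G′_K, all six entries, uniformly over
  all tori `(d, L, m, K)`, `d ≥ 1`, odd `L > 1`, `a > 0`, `m² ≥ 0`, every L² half `o`.

## HONEST SCOPE — what is NOT certified here

(i) Top level `k = K` only (`L^Kε = 1`): the G′_k of lower levels are top levels of other volumes up to a rescaling not formalised
here (`B4ThmZeroTorusEta` HONEST SCOPE (v)); p37's residual theorem covers all `k ≤ m + K`, the [2]-half here does not.  (ii) U = 1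
(A = 0), whole torus, sup torus distances, Δ̃(y) the closed sup-ball about the corner representative, the sup norm on R^N
(divergences D-pv07.17, `B4ThmZeroTorusEta` (viii)).  (iii) The constants are those of the cited theorems merged by `firstOrderGp_of_B4NN`
(c = 3 enters as `e^{3δ₀}`).  (iv) The second-order entries (1.112)–(1.113), the G/G₀ half of Prop. 1.2 and Prop. 1.1 are elsewhere
(`B5Prop12Chain`, `B5Prop12ChainNN`).  (v) Nothing here is summit progress.
-/

namespace Literature.MathematicalPhysics.QuantumFieldTheory.Balaban1983to89

namespace B5DictTorusEta

open Matrix B1RG242Torus B5Display136Torus B5Display135Torus B5Ineq137Torus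
open B4ThmZeroTorusEta B5GpSettingTorus B5FromB4 B5FromB4NN

noncomputable section

/-! ## §1 The top-level G′-family of record and the index map into the torus `EtaSetting` family -/

/-- **Index of the top-level G′-settings of record**: a volume `P = (d, L, m, K)` with `K ≥ 1` (G′_K on the torus of `2L^m` unit
blocks per direction, `η = L^{−K} = ε`). [cite: Balaban1984PropagatorsI, Prop. 1.2 p.35, (1.135) p.39; index bookkeeping] -/
structure GpTopIdx (d L : ℕ) where
  /-- the volume `(d, L, m, K)` -/
  P : Params
  hPd : P.d = d
  hPL : P.L = L
  /-- `K ≥ 1` -/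
  hK : 1 ≤ P.K

/-- **The top-level G′-family of record**: member `i` = `B5GpSettingTorus.gpSetting i.P a m² K (o i.P)` (Prop. 1.2's vocabulary for
G′ = G′_K on the torus `i.P`; the uninterpreted L²/Prop-1.1 half `o` is a parameter of the family, chosen per volume — it lives one
universe up, so it is not part of the index). [cite: Balaban1984PropagatorsI, Prop. 1.2 (1.108)–(1.113) pp.35–36, (1.135) p.39] -/
def famGpTop (d L : ℕ) (a msq : ℝ) (o : (P : Params) → L2Half P) (i : GpTopIdx d L) : B5.Setting :=
  gpSetting i.P a msq i.P.K (o i.P)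

/-- The two Hölder functionals of (1.111) of the member (`B5GpSettingTorus.gpHolder`). [cite: Balaban1984PropagatorsI, (1.111) p.35] -/
def holderTop (d L : ℕ) (a msq : ℝ) (o : (P : Params) → L2Half P) (i : GpTopIdx d L) : GpHolder (famGpTop d L a msq o i) :=
  gpHolder i.P a msq i.P.K (o i.P)

/-- The index map `ι i e`: the [2]-instance of the member `i` with charge `e` = the top level of the same volume in the torus
`EtaSetting` family (`B4ThmZeroTorusEta.TorusEtaIdx`). [cite: Balaban1984PropagatorsI, p.39 («In paper [2] we have proved …»);
bookkeeping] -/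
def iotaTop (d L : ℕ) (i : GpTopIdx d L) (e : ℝ) : TorusEtaIdx d L :=
  { P := i.P, hPd := i.hPd, hPL := i.hPL, hK := i.hK, e := e }

/-- NON-VACUITY of the index. [cite: Balaban1984PropagatorsI, Prop. 1.2 p.35; non-vacuity bookkeeping] -/
theorem gpTopIdx_nonempty (d L m K : ℕ) (hd : 1 ≤ d) (hL : Odd L ∧ 1 < L) (hK : 1 ≤ K) : Nonempty (GpTopIdx d L) :=
  ⟨{ P := ⟨d, L, m, K, hd, hL⟩, hPd := rfl, hPL := rfl, hK := hK }⟩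

/-! ## §2 Cube geometry at the top level -/

section Geometry

variable (P : Params)

/-- `εL^K = 1`. [cite: Balaban1984PropagatorsI, p.19 (L^Kε = 1); bookkeeping] -/
theorem eps_mul_LK : P.eps * (P.L : ℝ) ^ P.K = 1 := by
  have h := P.spacing_K
  unfold Params.spacing at h
  rwa [mul_comm] at h

/-- At the top level the setting's distance `|x − x′|` (η-units) is [2]'s `ε|x − x′|_T`. [cite: Balaban1984PropagatorsI, (1.109) p.35;
Balaban1983RegularityDecay, (1.9) p.573; bookkeeping] -/
theorem distX_top (x x' : Site P 0) : distX P P.K x x' = P.eps * T P 0 x x' := by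
  unfold distX Params.eps
  rw [inv_pow]

/-- **The enlarged cube**: `x` within sup distance `2` (η-units) of the corner representative of `y ∈ T₁^{(K)}` — Δ̃(y) together
with all partners `x′`, `|x − x′| ≤ 1`, of its points (the region on which the dictionary reads [2]'s pointwise bounds).
[cite: Balaban1984PropagatorsI, p.35 (the cubes Δ̃(y)), (1.109) («|x − x′| ≤ 1»)] -/
def bigCube (x : Site P 0) (y : Site P P.K) : Prop := T P 0 x (fine P P.K y) ≤ 2 * (P.L : ℝ) ^ P.K

variable {P}

/-- Δ̃(y) ⊂ the enlarged cube. [cite: Balaban1984PropagatorsI, p.35; bookkeeping] -/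
theorem inCube_bigCube {x : Site P 0} {y : Site P P.K} (h : inCube P P.K x y) : bigCube P x y := by
  unfold inCube at h
  unfold bigCube
  have : (0 : ℝ) ≤ (P.L : ℝ) ^ P.K := (pow_pos P.cast_L_pos _).le
  linarith

/-- A partner `x′`, `|x − x′| ≤ 1`, of a point `x ∈ Δ̃(y)` lies in the enlarged cube. [cite: Balaban1984PropagatorsI, p.35, (1.109);
bookkeeping] -/
theorem bigCube_of_near {x x' : Site P 0} {y : Site P P.K} (hx : inCube P P.K x y) (h1 : distX P P.K x x' ≤ 1) :
    bigCube P x' y := by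
  unfold inCube at hx
  unfold bigCube
  have hLK : (0 : ℝ) < (P.L : ℝ) ^ P.K := pow_pos P.cast_L_pos _
  have hxx' : T P 0 x x' ≤ (P.L : ℝ) ^ P.K := by
    unfold distX at h1
    have := mul_le_mul_of_nonneg_left h1 hLK.le
    rwa [← mul_assoc, mul_inv_cancel₀ hLK.ne', one_mul, mul_one] at this
  have t := T_triangle P 0 x' x (fine P P.K y)
  rw [T_symm P 0 x' x] at t
  linarith

/-- KEY GEOMETRY: `x` in the enlarged cube of `y`, `z ∈ Δ̃(y′)` ⇒ `L^K(|y − y′| − 3) ≤ |x − z|_T` (fine lattice units) — the corner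
representatives are at distance exactly `L^K|y − y′|` (`T_fine_fine`), triangle inequality twice.
[cite: Balaban1984PropagatorsI, p.35 (the cubes Δ̃(y)); bookkeeping] -/
theorem geom_big {x z : Site P 0} {y y' : Site P P.K} (hx : bigCube P x y) (hz : inCube P P.K z y') :
    (P.L : ℝ) ^ P.K * (T P P.K y y' - 3) ≤ T P 0 x z := by
  have e := T_fine_fine P (Nat.le_add_left P.K P.m) y y'
  have t1 := T_triangle P 0 (fine P P.K y) x (fine P P.K y')
  have t2 := T_triangle P 0 x z (fine P P.K y')
  rw [T_symm P 0 (fine P P.K y) x, e] at t1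
  unfold bigCube at hx
  unfold inCube at hz
  rw [mul_sub]
  linarith

/-- **CUBE-TO-SUPPORT, one point**: `x` in the enlarged cube of `y`, `supp J ⊂ Δ̃(y′)` ⇒ `|y − y′| − 3 ≤ ε·dist_T(x, supp J)` — also for
`J = 0` (`dist_T(x, ∅) = diam_T ≥ |x − (corner of y′)|_T`). [cite: Balaban1984PropagatorsI, (1.110) p.35 («x ∈ Δ̃(y), supp J ⊂ Δ̃(y′)»);
Balaban1983RegularityDecay, (1.10) p.573 («dist(x, supp f)»)] -/
theorem geom1_top {x : Site P 0} {y y' : Site P P.K} (J : Fin P.d → Site P 0 → ℝ) (hx : bigCube P x y)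
    (hJ : ∀ (ν : Fin P.d) (z : Site P 0), J ν z ≠ 0 → inCube P P.K z y') :
    T P P.K y y' - 3 ≤ P.eps * infT P x J := by
  have hb : (P.L : ℝ) ^ P.K * (T P P.K y y' - 3) ≤ infT P x J :=
    le_infT P x J ((geom_big hx (inCube_fine P.K y')).trans (T_le_diamT P x _)) fun n z hz => geom_big hx (hJ n z hz)
  have h := mul_le_mul_of_nonneg_left hb P.eps_pos.le
  rwa [← mul_assoc, eps_mul_LK, one_mul] at h

/-- **CUBE-TO-SUPPORT, a pair**: `x ∈ Δ̃(y)`, `|x − x′| ≤ 1`, `supp J ⊂ Δ̃(y′)` ⇒ `|y − y′| − 3 ≤ ε·dist_T({x, x′}, supp J)`.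
[cite: Balaban1984PropagatorsI, (1.111) p.35; Balaban1983RegularityDecay, (1.9) p.573 («dist({x,x′}, supp f)»)] -/
theorem geom2_top {x x' : Site P 0} {y y' : Site P P.K} (J : Fin P.d → Site P 0 → ℝ) (hx : inCube P P.K x y)
    (h1 : distX P P.K x x' ≤ 1) (hJ : ∀ (ν : Fin P.d) (z : Site P 0), J ν z ≠ 0 → inCube P P.K z y') :
    T P P.K y y' - 3 ≤ P.eps * infT2 P x x' J := by
  have hxb := inCube_bigCube hx
  have hx'b := bigCube_of_near hx h1
  have hb : (P.L : ℝ) ^ P.K * (T P P.K y y' - 3) ≤ infT2 P x x' J :=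
    le_infT2 P x x' J ((geom_big hxb (inCube_fine P.K y')).trans (T_le_diamT P x _))
      (fun n z hz => geom_big hxb (hJ n z hz)) (fun n z hz => geom_big hx'b (hJ n z hz))
  have h := mul_le_mul_of_nonneg_left hb P.eps_pos.le
  rwa [← mul_assoc, eps_mul_LK, one_mul] at h

variable (P) in
/-- `‖J‖_∞ ≤ |J|`: the sup norm over components and sites is below (in fact equal to) the norm (1.108) `max_ν sup_x|J_ν(x)|`.
[cite: Balaban1984PropagatorsI, (1.108) p.35; Balaban1983RegularityDecay, (1.10) p.573 («‖f‖_∞»)] -/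
theorem norm_le_supNormV (J : Fin P.d → Site P 0 → ℝ) : ‖J‖ ≤ supNormV P J := by
  refine (pi_norm_le_iff_of_nonneg (supNormV_nonneg J)).2 fun ν => ?_
  refine le_trans ((pi_norm_le_iff_of_nonneg (supN_nonneg P (J ν))).2 fun x => ?_) (supN_le_supNormV J ν)
  rw [Real.norm_eq_abs]
  exact le_supN P (J ν) x

/-- From the weighted form of (1.9), `(|x − x′|^{−1})^α·N ≤ b`, to `N ≤ b|x − x′|^α` (`|x − x′| > 0`). [cite: Balaban1983RegularityDecay,
(1.9) p.573; Balaban1984PropagatorsI, (1.109) p.35; bookkeeping] -/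
theorem le_mul_rpow_of_weighted {w N b α : ℝ} (hw : 0 < w) (h : (w⁻¹) ^ α * N ≤ b) : N ≤ b * w ^ α := by
  have hwa : 0 < w ^ α := Real.rpow_pos_of_pos hw α
  rw [Real.inv_rpow hw.le, inv_mul_le_iff₀ hwa] at h
  linarith [mul_comm (w ^ α) b]

end Geometry

/-! ## §3 The dictionary `B5FromB4.Dict`, PROVED for the concrete pair (torus `EtaSetting` member ↔ G′-setting of record, k = K) -/

section TheDict

variable (d L : ℕ) (a msq : ℝ) (o : (P : Params) → L2Half P)

/-- **THE [2]-DICTIONARY OF RECORD, PROVED, index-free form** (c = 3): for ANY volume `P` (`P.d = d`, `P.L = L`, `K ≥ 1`), any L²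
half `o` and any charge `e`, every field of `B5FromB4.Dict` between [2]'s torus instance `torusEtaFam d L a m² ⟨P, _, _, _, e⟩`
(G_K(T_η, 0) acting componentwise on `J : Fin d → T_η → ℝ`) and `gpSetting P a m² K o`: `loc = id`; `inCube x y` = the enlarged
cube; `inPair x x′ y` = (x ∈ Δ̃(y), x ≠ x′, |x − x′| ≤ 1); `geom1`/`geom2` = `geom1_top`/`geom2_top`; `supNorm_le` = `norm_le_supNormV`;
`e0_le`, `e1_le` = the cube sups of |G′_KJ_μ|, |∂_μG′_KJ_ν| below a common bound of [2]'s |(G_KJ)(x)|, |(D_μG_KJ)(x)| (sup norm on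
R^N) on the enlarged cube (`E0_top`, `ED_top`); `hD_le` = the product rule `hDV_le_of_pair` fed with (1.9) on the pairs and (1.10) on
the enlarged cube.  Any index type `I` of G′-settings `i ↦ gpSetting (P i) a m² (P i).K (o i)` reads it through
`ι i e := ⟨P i, _, _, _, e⟩`. [cite: Balaban1984PropagatorsI, (1.108)–(1.111) p.35, p.39 («In paper [2] we have proved all the
necessary properties of G′»); Balaban1983RegularityDecay, Theorem (1.9)–(1.10) p.573] -/
def dictAt (P : Params) (hPd : P.d = d) (hPL : P.L = L) (hK : 1 ≤ P.K) (o : L2Half P) (e : ℝ) :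
    Dict (torusEtaFam d L a msq { P := P, hPd := hPd, hPL := hPL, hK := hK, e := e }) (gpSetting P a msq P.K o)
      (gpHolder P a msq P.K o) 3 e where
  charge := rfl
  regular := trivial
  bigBlocks := trivial
  rect := trivial
  dir := dir0 P
  loc := fun J => J
  inCube := fun x y => bigCube P x y
  inPair := fun x x' y => inCube P P.K x y ∧ x ≠ x' ∧ distX P P.K x x' ≤ 1
  geom1 := fun x y J y' hx hJ => geom1_top J hx hJ
  geom2 := fun x x' y J y' hp hJ => geom2_top J hp.1 hp.2.2 hJ
  supNorm_le := fun J => norm_le_supNormV P J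
  e0_le := fun J y b h => entry_zero_le a msq P.K o J y fun μ x hx => by
    rw [E0_top]
    exact (abs_le_norm_cw P _ J x μ).trans (h x (inCube_bigCube hx))
  e1_le := fun J y b h => entry_one_le a msq P.K o J y fun μ ν x hx => by
    rw [ED_top]
    exact (abs_le_norm_cw P _ J x ν).trans (h μ x (inCube_bigCube hx))
  hD_le := fun J α ζ y b₁ b₂ hζ hb₁ hb₂ H1 H2 =>
    hDV_le_of_pair a msq P.K J α ζ y hζ hb₁ hb₂
      (fun μ ν x x' hx hne h1 => by
        refine ⟨?_, ?_⟩
        · -- the Hölder quotient of (1.9) on the pair (x, x′)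
          have hw : 0 < P.eps * T P 0 x x' := by
            rw [← distX_top]
            rcases (distX_nonneg P P.K x x').eq_or_lt with h0 | h0
            · exact absurd (eq_of_distX_eq_zero P h0.symm) hne
            · exact h0
          have hq : ((P.eps * T P 0 x x')⁻¹) ^ α *
              ‖cw P (deriv P 0 P.eps μ * (tower P a msq).G P.K) J x' -
                cw P (deriv P 0 P.eps μ * (tower P a msq).G P.K) J x‖ ≤ b₁ := H1 μ x x' ⟨hx, hne, h1⟩
          rw [ED_top, ED_top, distX_top]
          exact (abs_sub_le_norm_cw_sub P _ J x x' ν).trans (le_mul_rpow_of_weighted hw hq)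
        · -- (1.10) at the partner x′ (in the enlarged cube)
          rw [ED_top]
          exact (abs_le_norm_cw P _ J x' ν).trans (H2 μ x' (bigCube_of_near hx h1)))
      (fun μ ν x hx => by
        rw [ED_top]
        exact (abs_le_norm_cw P _ J x ν).trans (H2 μ x (inCube_bigCube hx)))

/-- **THE [2]-DICTIONARY OF RECORD for the member `i` of the top-level family** (`dictAt` read through `iotaTop`).
[cite: Balaban1984PropagatorsI, (1.108)–(1.111) p.35, p.39; Balaban1983RegularityDecay, Theorem (1.9)–(1.10) p.573] -/
def dictTop (i : GpTopIdx d L) (e : ℝ) :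
    Dict (torusEtaFam d L a msq (iotaTop d L i e)) (famGpTop d L a msq o i) (holderTop d L a msq o i) 3 e :=
  dictAt d L a msq i.P i.hPd i.hPL i.hK (o i.P) e

/-- The dictionary exists for every member and every positive charge (the shape `firstOrderGp_of_B4NN` consumes).
[cite: Balaban1984PropagatorsI, p.39; bookkeeping] -/
theorem dictTop_forall : ∀ (i : GpTopIdx d L) (e : ℝ), 0 < e →
    Nonempty (Dict (torusEtaFam d L a msq (iotaTop d L i e)) (famGpTop d L a msq o i) (holderTop d L a msq o i) 3 e) :=
  fun i e _ => ⟨dictTop d L a msq o i e⟩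

end TheDict

/-! ## §4 The first-order entries (1.110)–(1.111) for G′_K on every torus -/

section FirstOrder

variable (d L : ℕ) (hd : 1 ≤ d) (hL : Odd L ∧ 1 < L) {a : ℝ} (ha : 0 < a) {msq : ℝ} (hmsq : 0 ≤ msq)
  (o : (P : Params) → L2Half P)
include hd hL ha hmsq

/-- **(1.110)–(1.111) FOR G′_K FROM [2] VIA THE DICTIONARY, modulo the residual entries**: `ResidualGpFirst ⇒ FirstOrderFam` for
the top-level family — `B5FromB4NN.firstOrderGp_of_B4NN` with `hThm := B4ThmZeroTorusEta.thmDepPrintedNN_torusEtaFam`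
(hypothesis-free) and `D := dictTop`. [cite: Balaban1984PropagatorsI, Prop. 1.2 (1.110)–(1.111) p.35, p.39; Balaban1983RegularityDecay,
Theorem p.573] -/
theorem firstOrderFam_top_of_residual (hRes : ResidualGpFirst (famGpTop d L a msq o) (holderTop d L a msq o)) :
    FirstOrderFam (famGpTop d L a msq o) :=
  firstOrderGp_of_B4NN (torusEtaFam d L a msq) (famGpTop d L a msq o) (holderTop d L a msq o) 3 (iotaTop d L)
    (fun i e _ => dictTop d L a msq o i e) (fun i => modelSigns_gpSetting a msq i.P.K (o i.P))
    (thmDepPrintedNN_torusEtaFam d L hd hL ha hmsq) hRes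

/-- **THE RESIDUAL ENTRIES FOR THE TOP-LEVEL FAMILY, hypothesis-free**: |(G′∇*J)(x)|, |(ΔG′J)(x)| of (1.110) and ‖ζG′∇*J‖_α of
(1.111) for G′_K — seat p37's `B5ResidualGpTorus.residualGpFirst_torus` at its own dictionaries for the setting of record
(`cubeFacts_gpSetting`, `dict137_gpSetting`, `dictGp_gpSetting`, `modelSigns_gpSetting`), mass cap `m²₊ = m²` (`L^Kε = 1`).
[cite: Balaban1984PropagatorsI, (1.110)–(1.111) p.35, (1.135) p.39; Balaban1983RegularityDecay, Lemma 2.4 p.582] -/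
theorem residualGpFirst_top : ResidualGpFirst (famGpTop d L a msq o) (holderTop d L a msq o) :=
  B5ResidualGpTorus.residualGpFirst_torus d L hd hL ha hmsq msq 2 (fun i : GpTopIdx d L => i.P) (fun i => i.hPd)
    (fun i => i.hPL) (famGpTop d L a msq o) (holderTop d L a msq o) (fun i => inCube i.P i.P.K)
    (fun i => compV i.P a msq i.P.K (o i.P)) (fun i => i.hK) (fun i => Nat.le_add_left i.P.K i.P.m)
    (fun i => by
      show i.P.spacing i.P.K ^ 2 * msq ≤ msq
      rw [i.P.spacing_K, one_pow, one_mul])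
    (fun i => cubeFacts_gpSetting a msq (Nat.le_add_left i.P.K i.P.m) (o i.P))
    (fun i => by
      obtain ⟨P, hPd, hPL, hK⟩ := i
      subst hPd
      exact dict137_gpSetting a msq P.K (o P))
    (fun i => by
      obtain ⟨P, hPd, hPL, hK⟩ := i
      subst hPd
      exact dictGp_gpSetting a msq P.K (o P))
    (fun i => modelSigns_gpSetting a msq i.P.K (o i.P))

/-- **(1.110)–(1.111) FOR G′ = G′_K ON EVERY TORUS, ALL SIX ENTRIES, HYPOTHESIS-FREE** — `B5FromB4.FirstOrderFam (famGpTop d L a m²)`: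
there are `δ₀ > 0`, `C > 0`, `C(α)` such that for every volume `(d, L, m, K)` (`K ≥ 1`), every `y, y′ ∈ T₁^{(K)}`, every `J` with
`supp J ⊂ Δ̃(y′)`: the four sup entries of (1.110) over Δ̃(y) are `≤ Ce^{−δ₀|y−y′|}|J|` and, for `0 ≤ α < 1` and `supp ζ ⊂ Δ̃(y)`,
`max(‖ζ∇G′J‖_α, ‖ζG′∇*J‖_α) ≤ C(α)e^{−δ₀|y−y′|}(‖ζ‖_α + |ζ|)|J|` — B5's «In paper [2] we have proved all the necessary properties of
G′, except the second order inequalities» made a theorem of the torus: [2]'s Theorem (`B4Thm110ZeroTorus`, `B4Thm19ZeroTorus`) for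
|G′J|, |∇G′J|, ‖ζ∇G′J‖_α through `dictTop`, the located leaves of Lemma 2.4 / (1.135) (`B5ResidualGpTorus`) for the rest (`o`, the
uninterpreted L² half, is arbitrary). [cite: Balaban1984PropagatorsI, Prop. 1.2 (1.110)–(1.111) p.35, p.39; Balaban1983RegularityDecay,
Theorem (1.9)–(1.10) p.573, Lemma 2.4 p.582] -/
theorem firstOrderFam_top : FirstOrderFam (famGpTop d L a msq o) :=
  firstOrderFam_top_of_residual d L hd hL ha hmsq o (residualGpFirst_top d L hd hL ha hmsq o)

omit hd hL ha hmsq in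
/-- A concrete instance, for the record: `d = 3`, `L = 3`, `a = 1`, `m² = 0` (and the family is non-empty: `gpTopIdx_nonempty`).
[cite: Balaban1984PropagatorsI, Prop. 1.2 p.35; instance bookkeeping] -/
example : FirstOrderFam (famGpTop 3 3 1 0 fun _ => default) :=
  firstOrderFam_top 3 3 (by norm_num) ⟨⟨1, by norm_num⟩, by norm_num⟩ one_pos le_rfl _

end FirstOrder

end

end B5DictTorusEta

end Literature.MathematicalPhysics.QuantumFieldTheory.Balaban1983to89
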